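import Mathlib
import Summits.ValiantsHypothesis.ValiantsHypothesis.Theorems.BarrierLeverTransversalMinorLayoutsCompression
import Summits.ValiantsHypothesis.ValiantsHypothesis.Theorems.BarrierLeverTransversalMinorLayoutsCompressionIso

/-!
# Route BarrierLever — conjecture TT (`TransversalMinorLayoutsNonsingular`,
# stmt-ValiantsHypothesis-19152): reduction to pairs of SIMPLICIAL COMPLEXES (lower sets)

Cell valiant-natproofs, rung V4, 𝒟-side chain … ⇒ TT (19152) ⇒ TNS (19126) ⇒ 19717; seat
val-np-p2 gen 3.  Notation of the compression files (`…TransversalMinorLayoutsCompression*`,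
namespace `…Compression`): the TT layout matrix of `(u, w)` is the pairing matrix of the row
transversals `ρ_{u i}` (`a ↦ castAdd h a` on `u i`, `natAdd h a` off it) and the column
transversals `τ_{w j}` (`c ↦ natAdd h c` on `w j`, `castAdd h c` off it); `(u, w)` is *good* when
this matrix is nonsingular for some `H`.

The free move `pairing_good_of_compression` (p428070) specialised to the two symbols of ONE site
is the classical DOWN-COMPRESSION of set families: on the row layout the compression
`castAdd h a → natAdd h a` replaces `u i` by `(u i).erase a` whenever `a ∈ u i` and the erased set
is not already a member (`tt_layout_of_row_compression`); on the column layout the compression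
`natAdd h c → castAdd h c` does the same to `w` (`tt_layout_of_col_compression`).  Each step lowers
`Σ |u i| + Σ |w j|`, and a layout admitting no such step has a LOWER SET as its range — an abstract
simplicial complex (`isLowerSet_range_of_forall_erase_mem`).  Consequently

* `tt_level_of_lowerSets`: at each `h`, TT for all injective layout pairs follows from TT for the
  injective layout pairs whose ranges are lower sets;
* `transversalMinorLayoutsNonsingular_of_lowerSets`: item 19152 follows from its restriction to
  pairs of simplicial complexes with the same number of faces.

For a lower set the class size `#{i : a ∈ u i}` is the number of faces containing the vertex `a`
(at most `r / 2`), so after this reduction the residue of the literal-pair split R1 (items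
19587 / 19616) consists of the pairs of complexes with equal face numbers and DISJOINT vertex-degree
sets — e.g. the claw `{∅,1,2,3}` against the square `{∅,1,2,12}` at `h = 3`, or the 3-simplex
`2^{1,2,3}` against the star-plus-edge `{∅,1,…,6,12}` at `h = 6` (the latter defeats the
depth-one compression recipes of memo HOME/val-np-p2/COMPRESSION-MEMO-g2.md §3b, seat folder
scripts/explore.py).

Definition-free; Mathlib plus the compression files.  WHAT THIS IS NOT: no proof of TT / TNS /
item 19717; nothing here bears on crux 14610 or on VP versus VNP.
-/

-- layout Summits/ValiantsHypothesis/ValiantsHypothesis forces the duplicated namespace component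
set_option linter.dupNamespace false

open Matrix Finset

namespace Summit.ValiantsHypothesis.ValiantsHypothesis.Theorems.BarrierLever.Compression

/-! ## 1. Small facts about the symbols and the down-compressed layout -/

/-- A first-half symbol `castAdd h a` never equals a second-half symbol `natAdd h b`. -/
theorem castAdd_ne_natAdd_sym (h : ℕ) (a b : Fin h) : Fin.castAdd h a ≠ Fin.natAdd h b := by
  intro e
  have hv := congrArg Fin.val e
  simp only [Fin.val_castAdd, Fin.val_natAdd] at hv
  omega

/-- `natAdd h` is injective (value computation). -/
theorem eq_of_natAdd_eq_sym (h : ℕ) {a b : Fin h} (e : Fin.natAdd h a = Fin.natAdd h b) :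
    a = b := by
  have hv := congrArg Fin.val e
  simp only [Fin.val_natAdd] at hv
  exact Fin.ext (by omega)

/-- The down-compression of an injective layout at a site is injective. -/
theorem downCompress_injective {h r : ℕ} (u : Fin r → Finset (Fin h))
    (hu : Function.Injective u) (a : Fin h) :
    Function.Injective (fun i =>
      if a ∈ u i ∧ (u i).erase a ∉ Finset.univ.image u then (u i).erase a else u i) := by
  classical
  intro i j hij
  dsimp only at hij
  by_cases hi : a ∈ u i ∧ (u i).erase a ∉ Finset.univ.image u <;>
    by_cases hj : a ∈ u j ∧ (u j).erase a ∉ Finset.univ.image u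
  · rw [if_pos hi, if_pos hj] at hij
    apply hu
    rw [← Finset.insert_erase hi.1, ← Finset.insert_erase hj.1, hij]
  · rw [if_pos hi, if_neg hj] at hij
    exact absurd (Finset.mem_image.mpr ⟨j, Finset.mem_univ _, hij.symm⟩) hi.2
  · rw [if_neg hi, if_pos hj] at hij
    exact absurd (Finset.mem_image.mpr ⟨i, Finset.mem_univ _, hij⟩) hj.2
  · rw [if_neg hi, if_neg hj] at hij
    exact hu hij

/-- Down-compression strictly lowers the total size as soon as one member moves. -/
theorem sum_card_downCompress_lt {h r : ℕ} (u : Fin r → Finset (Fin h)) (a : Fin h) (i₀ : Fin r)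
    (hi₀ : a ∈ u i₀ ∧ (u i₀).erase a ∉ Finset.univ.image u) :
    (∑ i, (if a ∈ u i ∧ (u i).erase a ∉ Finset.univ.image u then (u i).erase a else u i).card) <
      ∑ i, (u i).card := by
  classical
  apply Finset.sum_lt_sum
  · intro i _
    by_cases hi : a ∈ u i ∧ (u i).erase a ∉ Finset.univ.image u
    · rw [if_pos hi]; exact Finset.card_erase_le
    · rw [if_neg hi]
  · exact ⟨i₀, Finset.mem_univ _, by rw [if_pos hi₀]; exact Finset.card_erase_lt_of_mem hi₀.1⟩

/-- A layout admitting no down-compression step has a lower set (a simplicial complex) as range. -/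
theorem isLowerSet_range_of_forall_erase_mem {h r : ℕ} (u : Fin r → Finset (Fin h))
    (hall : ∀ i a, a ∈ u i → (u i).erase a ∈ Finset.univ.image u) :
    IsLowerSet (Set.range u) := by
  classical
  -- removing the elements of `s \ t` one at a time stays inside the range
  suffices key : ∀ (n : ℕ) (s t : Finset (Fin h)), t ⊆ s → (s \ t).card = n →
      s ∈ Set.range u → t ∈ Set.range u by
    intro s t hts hs
    exact key _ s t hts rfl hs
  intro n
  induction n with
  | zero =>
    intro s t hts hc hs
    have hst : s = t := by
      refine le_antisymm ?_ hts
      intro x hx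
      by_contra hxt
      have : x ∈ s \ t := Finset.mem_sdiff.mpr ⟨hx, hxt⟩
      rw [Finset.card_eq_zero] at hc
      rw [hc] at this
      exact absurd this (Finset.notMem_empty x)
    rw [← hst]; exact hs
  | succ n ih =>
    intro s t hts hc hs
    obtain ⟨x, hx⟩ : (s \ t).Nonempty := by
      rw [← Finset.card_pos, hc]; exact Nat.succ_pos n
    have hxs : x ∈ s := (Finset.mem_sdiff.mp hx).1
    have hxt : x ∉ t := (Finset.mem_sdiff.mp hx).2
    obtain ⟨i, rfl⟩ := hs
    obtain ⟨i', _, hi'⟩ := Finset.mem_image.mp (hall i x hxs)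
    refine ih ((u i).erase x) t ?_ ?_ ⟨i', hi'⟩
    · intro y hy
      exact Finset.mem_erase.mpr ⟨fun e => hxt (e ▸ hy), hts hy⟩
    · rw [Finset.erase_sdiff_comm, Finset.card_erase_of_mem hx, hc]
      rfl

/-! ## 2. One down-compression step is a free move -/

/-- FREE MOVE on the rows (no injectivity needed): if the layout matrix of the down-compressed row
layout (at site `a`) against `w` is nonsingular for some `H`, then so is that of `u` against `w`.
This is
`pairing_good_of_compression` for the symbols `castAdd h a → natAdd h a`: the moved members are the
`u i ∋ a` whose erased copy is not a member, and an unmoved member containing `a` is blocked by the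
member equal to its erased copy. -/
theorem tt_layout_of_row_compression (h r : ℕ) (u w : Fin r → Finset (Fin h)) (a : Fin h)
    (hgood : ∃ H : Matrix (Fin (h + h)) (Fin (h + h)) ℂ,
      (Matrix.of fun i j : Fin r => (H.submatrix
        (fun b : Fin h =>
          if b ∈ (if a ∈ u i ∧ (u i).erase a ∉ Finset.univ.image u then (u i).erase a else u i)
          then Fin.castAdd h b else Fin.natAdd h b)
        (fun c : Fin h => if c ∈ w j then Fin.natAdd h c else Fin.castAdd h c)).det).det ≠ 0) :
    ∃ H : Matrix (Fin (h + h)) (Fin (h + h)) ℂ,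
      (Matrix.of fun i j : Fin r => (H.submatrix
        (fun b : Fin h => if b ∈ u i then Fin.castAdd h b else Fin.natAdd h b)
        (fun c : Fin h => if c ∈ w j then Fin.natAdd h c else Fin.castAdd h c)).det).det ≠ 0 := by
  classical
  refine pairing_good_of_compression
    (fun (i : Fin r) (b : Fin h) => if b ∈ u i then Fin.castAdd h b else Fin.natAdd h b)
    (fun (i : Fin r) (b : Fin h) =>
      if b ∈ (if a ∈ u i ∧ (u i).erase a ∉ Finset.univ.image u then (u i).erase a else u i)
      then Fin.castAdd h b else Fin.natAdd h b)
    (fun (j : Fin r) (c : Fin h) => if c ∈ w j then Fin.natAdd h c else Fin.castAdd h c)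
    (Fin.castAdd h a) (Fin.natAdd h a) (castAdd_ne_natAdd_sym h a a)
    (Finset.univ.filter fun i => a ∈ u i ∧ (u i).erase a ∉ Finset.univ.image u)
    (fun i => ResultantKernel.rowT_injective h (u i)) ?_ ?_ ?_ ?_ hgood
  · -- moved members contain `castAdd a` and not `natAdd a`
    intro i hi
    rw [Finset.mem_filter] at hi
    refine ⟨⟨a, by simp [hi.2.1]⟩, fun b => ?_⟩
    by_cases hb : b ∈ u i
    · simp only [hb, if_true]; exact castAdd_ne_natAdd_sym h b a
    · simp only [hb, if_false]
      intro e
      exact hb ((eq_of_natAdd_eq_sym h e) ▸ hi.2.1)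
  · -- the moved members are the shifted copies
    intro i hi b
    rw [Finset.mem_filter] at hi
    simp only [if_pos hi.2]
    by_cases hba : b = a
    · subst hba
      simp [hi.2.1]
    · have hF : (if b ∈ u i then Fin.castAdd h b else Fin.natAdd h b) ≠ Fin.castAdd h a := by
        by_cases hb : b ∈ u i
        · simp only [hb, if_true]; exact fun e => hba (Fin.castAdd_inj.mp e)
        · simp only [hb, if_false]; exact fun e => castAdd_ne_natAdd_sym h a b e.symm
      rw [if_neg hF]
      simp [Finset.mem_erase, hba]
  · -- unmoved members are unchanged
    intro i hi
    have hi' : ¬ (a ∈ u i ∧ (u i).erase a ∉ Finset.univ.image u) := by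
      intro hc; exact hi (Finset.mem_filter.mpr ⟨Finset.mem_univ _, hc⟩)
    funext b
    simp only [if_neg hi']
  · -- an unmoved member containing `castAdd a` is blocked by its erased copy
    intro i hi hex _
    obtain ⟨b₀, hb₀⟩ := hex
    have hab : a ∈ u i := by
      by_cases hb : b₀ ∈ u i
      · simp only [hb, if_true] at hb₀
        exact (Fin.castAdd_inj.mp hb₀) ▸ hb
      · simp only [hb, if_false] at hb₀
        exact absurd hb₀.symm (castAdd_ne_natAdd_sym h a b₀)
    have hmem : (u i).erase a ∈ Finset.univ.image u := by
      by_contra hc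
      exact hi (Finset.mem_filter.mpr ⟨Finset.mem_univ _, hab, hc⟩)
    obtain ⟨i', _, hi'⟩ := Finset.mem_image.mp hmem
    refine ⟨i', Equiv.refl _, fun b => ?_⟩
    simp only [Equiv.refl_apply]
    by_cases hba : b = a
    · subst hba
      simp [hi', hab]
    · have hF : (if b ∈ u i then Fin.castAdd h b else Fin.natAdd h b) ≠ Fin.castAdd h a := by
        by_cases hb : b ∈ u i
        · simp only [hb, if_true]; exact fun e => hba (Fin.castAdd_inj.mp e)
        · simp only [hb, if_false]; exact fun e => castAdd_ne_natAdd_sym h a b e.symm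
      rw [if_neg hF, hi']
      simp [Finset.mem_erase, hba]

/-- FREE MOVE on the columns: the same for the column layout `w`, via
`pairing_good_of_compression'` for the symbols `natAdd h c → castAdd h c`. -/
theorem tt_layout_of_col_compression (h r : ℕ) (u w : Fin r → Finset (Fin h)) (c : Fin h)
    (hgood : ∃ H : Matrix (Fin (h + h)) (Fin (h + h)) ℂ,
      (Matrix.of fun i j : Fin r => (H.submatrix
        (fun b : Fin h => if b ∈ u i then Fin.castAdd h b else Fin.natAdd h b)
        (fun b : Fin h =>
          if b ∈ (if c ∈ w j ∧ (w j).erase c ∉ Finset.univ.image w then (w j).erase c else w j)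
          then Fin.natAdd h b else Fin.castAdd h b)).det).det ≠ 0) :
    ∃ H : Matrix (Fin (h + h)) (Fin (h + h)) ℂ,
      (Matrix.of fun i j : Fin r => (H.submatrix
        (fun b : Fin h => if b ∈ u i then Fin.castAdd h b else Fin.natAdd h b)
        (fun b : Fin h => if b ∈ w j then Fin.natAdd h b else Fin.castAdd h b)).det).det ≠ 0 := by
  classical
  refine pairing_good_of_compression'
    (fun (i : Fin r) (b : Fin h) => if b ∈ u i then Fin.castAdd h b else Fin.natAdd h b)
    (fun (j : Fin r) (b : Fin h) => if b ∈ w j then Fin.natAdd h b else Fin.castAdd h b)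
    (fun (j : Fin r) (b : Fin h) =>
      if b ∈ (if c ∈ w j ∧ (w j).erase c ∉ Finset.univ.image w then (w j).erase c else w j)
      then Fin.natAdd h b else Fin.castAdd h b)
    (Fin.natAdd h c) (Fin.castAdd h c) (fun e => castAdd_ne_natAdd_sym h c c e.symm)
    (Finset.univ.filter fun j => c ∈ w j ∧ (w j).erase c ∉ Finset.univ.image w)
    (fun j => ResultantKernel.colT_injective h (w j)) ?_ ?_ ?_ ?_ hgood
  · intro j hj
    rw [Finset.mem_filter] at hj
    refine ⟨⟨c, by simp [hj.2.1]⟩, fun b => ?_⟩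
    by_cases hb : b ∈ w j
    · simp only [hb, if_true]; exact fun e => castAdd_ne_natAdd_sym h c b e.symm
    · simp only [hb, if_false]
      intro e
      exact hb ((Fin.castAdd_inj.mp e) ▸ hj.2.1)
  · intro j hj b
    rw [Finset.mem_filter] at hj
    simp only [if_pos hj.2]
    by_cases hbc : b = c
    · subst hbc
      simp [hj.2.1]
    · have hF : (if b ∈ w j then Fin.natAdd h b else Fin.castAdd h b) ≠ Fin.natAdd h c := by
        by_cases hb : b ∈ w j
        · simp only [hb, if_true]; exact fun e => hbc (eq_of_natAdd_eq_sym h e)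
        · simp only [hb, if_false]; exact castAdd_ne_natAdd_sym h b c
      rw [if_neg hF]
      simp [Finset.mem_erase, hbc]
  · intro j hj
    have hj' : ¬ (c ∈ w j ∧ (w j).erase c ∉ Finset.univ.image w) := by
      intro hc; exact hj (Finset.mem_filter.mpr ⟨Finset.mem_univ _, hc⟩)
    funext b
    simp only [if_neg hj']
  · intro j hj hex _
    obtain ⟨b₀, hb₀⟩ := hex
    have hcw : c ∈ w j := by
      by_cases hb : b₀ ∈ w j
      · simp only [hb, if_true] at hb₀
        exact (eq_of_natAdd_eq_sym h hb₀) ▸ hb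
      · simp only [hb, if_false] at hb₀
        exact absurd hb₀ (castAdd_ne_natAdd_sym h b₀ c)
    have hmem : (w j).erase c ∈ Finset.univ.image w := by
      by_contra hc
      exact hj (Finset.mem_filter.mpr ⟨Finset.mem_univ _, hcw, hc⟩)
    obtain ⟨j', _, hj'⟩ := Finset.mem_image.mp hmem
    refine ⟨j', Equiv.refl _, fun b => ?_⟩
    simp only [Equiv.refl_apply]
    by_cases hbc : b = c
    · subst hbc
      simp [hj', hcw]
    · have hF : (if b ∈ w j then Fin.natAdd h b else Fin.castAdd h b) ≠ Fin.natAdd h c := by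
        by_cases hb : b ∈ w j
        · simp only [hb, if_true]; exact fun e => hbc (eq_of_natAdd_eq_sym h e)
        · simp only [hb, if_false]; exact castAdd_ne_natAdd_sym h b c
      rw [if_neg hF, hj']
      simp [Finset.mem_erase, hbc]

/-! ## 3. Reduction of TT to pairs of lower sets -/

/-- LEVEL-WISE REDUCTION.  Fix `h`.  If the TT layout matrix is nonsingular (for some `H`) for
every pair of injective layouts whose ranges are LOWER SETS (simplicial complexes containing `∅`),
then it is nonsingular for every pair of injective layouts in dimension `h`.  Induction on the
total size `Σ |u i| + Σ |w j|`, one down-compression step at a time. -/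
theorem tt_level_of_lowerSets (h : ℕ)
    (hyp : ∀ (r : ℕ) (u w : Fin r → Finset (Fin h)), Function.Injective u →
      Function.Injective w → IsLowerSet (Set.range u) → IsLowerSet (Set.range w) →
      ∃ H : Matrix (Fin (h + h)) (Fin (h + h)) ℂ, (Matrix.of fun i j : Fin r => (H.submatrix
        (fun b : Fin h => if b ∈ u i then Fin.castAdd h b else Fin.natAdd h b)
        (fun b : Fin h => if b ∈ w j then Fin.natAdd h b else Fin.castAdd h b)).det).det ≠ 0)
    (r : ℕ) (u w : Fin r → Finset (Fin h)) (hu : Function.Injective u)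
    (hw : Function.Injective w) :
    ∃ H : Matrix (Fin (h + h)) (Fin (h + h)) ℂ, (Matrix.of fun i j : Fin r => (H.submatrix
      (fun b : Fin h => if b ∈ u i then Fin.castAdd h b else Fin.natAdd h b)
      (fun b : Fin h => if b ∈ w j then Fin.natAdd h b else Fin.castAdd h b)).det).det ≠ 0 := by
  classical
  suffices key : ∀ (N : ℕ) (u w : Fin r → Finset (Fin h)), Function.Injective u →
      Function.Injective w → (∑ i, (u i).card) + (∑ j, (w j).card) ≤ N →
      ∃ H : Matrix (Fin (h + h)) (Fin (h + h)) ℂ, (Matrix.of fun i j : Fin r => (H.submatrix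
        (fun b : Fin h => if b ∈ u i then Fin.castAdd h b else Fin.natAdd h b)
        (fun b : Fin h => if b ∈ w j then Fin.natAdd h b else Fin.castAdd h b)).det).det ≠ 0 from
    key _ u w hu hw le_rfl
  intro N
  induction N with
  | zero =>
    intro u w hu hw hN
    have hu0 : ∀ i, u i = ∅ := by
      intro i
      have : (u i).card = 0 := by
        have h1 : (u i).card ≤ ∑ i, (u i).card :=
          Finset.single_le_sum (f := fun i => (u i).card) (fun i _ => Nat.zero_le _)
            (Finset.mem_univ i)
        omega
      exact Finset.card_eq_zero.mp this
    have hw0 : ∀ j, w j = ∅ := by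
      intro j
      have : (w j).card = 0 := by
        have h1 : (w j).card ≤ ∑ j, (w j).card :=
          Finset.single_le_sum (f := fun j => (w j).card) (fun j _ => Nat.zero_le _)
            (Finset.mem_univ j)
        omega
      exact Finset.card_eq_zero.mp this
    refine hyp r u w hu hw ?_ ?_
    · exact isLowerSet_range_of_forall_erase_mem u (fun i a ha => by simp [hu0 i] at ha)
    · exact isLowerSet_range_of_forall_erase_mem w (fun j c hc => by simp [hw0 j] at hc)
  | succ N ih =>
    intro u w hu hw hN
    by_cases hcu : ∀ i a, a ∈ u i → (u i).erase a ∈ Finset.univ.image u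
    · by_cases hcw : ∀ j c, c ∈ w j → (w j).erase c ∈ Finset.univ.image w
      · exact hyp r u w hu hw (isLowerSet_range_of_forall_erase_mem u hcu)
          (isLowerSet_range_of_forall_erase_mem w hcw)
      · push Not at hcw
        obtain ⟨j₀, c, hc, hnot⟩ := hcw
        refine tt_layout_of_col_compression h r u w c (ih u _ hu (downCompress_injective w hw c) ?_)
        have hlt := sum_card_downCompress_lt w c j₀ ⟨hc, hnot⟩
        omega
    · push Not at hcu
      obtain ⟨i₀, a, ha, hnot⟩ := hcu
      refine tt_layout_of_row_compression h r u w a (ih _ w (downCompress_injective u hu a) hw ?_)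
      have hlt := sum_card_downCompress_lt u a i₀ ⟨ha, hnot⟩
      omega

/-- **TT reduces to pairs of simplicial complexes.**  Item 19152
(`TransversalMinorLayoutsNonsingular`) follows from its restriction to pairs of injective layouts
`u, w` whose ranges are lower sets of `Finset (Fin h)` (abstract simplicial complexes with the
same number `r` of faces, `∅` included). -/
theorem transversalMinorLayoutsNonsingular_of_lowerSets
    (hyp : ∀ (h r : ℕ) (u w : Fin r → Finset (Fin h)), Function.Injective u →
      Function.Injective w → IsLowerSet (Set.range u) → IsLowerSet (Set.range w) →
      ∃ H : Matrix (Fin (h + h)) (Fin (h + h)) ℂ, (Matrix.of fun i j : Fin r => (H.submatrix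
        (fun a : Fin h => if a ∈ u i then Fin.castAdd h a else Fin.natAdd h a)
        (fun c : Fin h => if c ∈ w j then Fin.natAdd h c else Fin.castAdd h c)).det).det ≠ 0) :
    Theses.BarrierLever.TransversalMinorLayoutsNonsingular := by
  intro h r u w hu hw
  exact tt_level_of_lowerSets h (hyp h) r u w hu hw

end Summit.ValiantsHypothesis.ValiantsHypothesis.Theorems.BarrierLever.Compression
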